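import Summits.ResolutionOfSingularities.ResolutionOfSingularities.Theorems.Globalisation.Negative.StubCaSheafMatrixFactorisation
import Literature.RingTheory.CohomologyAnnihilator.Localization
import Mathlib.LinearAlgebra.Isomorphisms
import Mathlib.Algebra.Homology.DerivedCategory.Ext.EnoughProjectives
import Mathlib.Tactic.LinearCombination
import HarnessLib

/-!
# `Ext` bookkeeping for the matrix-factorisation modules (for `StubCaSheafFalse`)

Negative-lemma chain for crux `Globalisation` (stmt-ResolutionOfSingularities-16486), file 5/6.
`M_c = coker φ_c`, `M'_c = coker ψ_c`, the syzygy sequences `S₁ : 0 → ΩM_c → R² → M_c → 0`,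
`S₂ : 0 → ΩM'_c → R² → M'_c → 0`, the 2-periodicity isomorphisms `M_c ≅ ΩM'_c`, `M'_c ≅ ΩM_c`
(from the exactness of file 4), the injective connecting maps (contravariant long exact
sequence, `Ext` out of a free module vanishes), the descent
"`r ∈ caⁿ⁺¹(R)` ⇒ `r` kills `Ext¹(M_c, -)`", the splitting criterion (covariant long exact sequence:
`r·[S₁] = 0` ⇒ `r • 𝟙_{M_c}` lifts through `R² ↠ M_c`) and its unwinding to the scalar identity
`r + (y + xg)κ₀ + (x - g²)κ₁ = (y - xg)l₀ - x²l₁` in `R`.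
-/

set_option linter.dupNamespace false

-- nested polynomial rings (`k[z][x][y]`) need nested instance synthesis during unification
set_option maxSynthPendingDepth 3

noncomputable section

namespace Summit.ResolutionOfSingularities.ResolutionOfSingularities.Theorems.Globalisation.Negative

open CategoryTheory CategoryTheory.Abelian Literature.RingTheory.CohomologyAnnihilator

/-! ## `Ext` bookkeeping for the matrix-factorisation modules -/

namespace CuspCylinder

open CategoryTheory CategoryTheory.Abelian Literature.RingTheory.CohomologyAnnihilator

section generic

universe w w'

variable {A : Type w'} [CommRing A]

/-- Dimension shifting, injective half: along a short exact sequence with projective middle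
term, if `r` kills `Ext^{i+2}(X₃, Y)` then it kills `Ext^{i+1}(X₁, Y)`. [folklore] -/
theorem smul_ext_eq_zero_of_shortExact [Small.{w} A] {S : ShortComplex (ModuleCat.{w} A)}
    (hS : S.ShortExact) [Projective S.X₂] {Y : ModuleCat.{w} A} {i : ℕ} (r : A)
    (h : ∀ e : Ext S.X₃ Y (i + 2), r • e = 0) (e : Ext S.X₁ Y (i + 1)) : r • e = 0 := by
  have h1 : hS.extClass.comp (r • e) (show 1 + (i + 1) = i + 2 by omega) = 0 := by
    rw [Ext.comp_smul]
    exact h _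
  obtain ⟨x₂, hx₂⟩ := Ext.contravariant_sequence_exact₁ hS Y (r • e) _ h1
  rw [← hx₂, Ext.eq_zero_of_projective x₂, Ext.comp_zero]

end generic

variable (k : Type) [Field k] (c : k)

/-- `M_c = coker φ_c`. -/
abbrev M := (Fin 2 → R k) ⧸ LinearMap.range (φ k c)

/-- `M'_c = coker ψ_c`. -/
abbrev M' := (Fin 2 → R k) ⧸ LinearMap.range (ψ k c)

/-- The projections `R² → M_c`, `R² → M'_c`. -/
def pM : (Fin 2 → R k) →ₗ[R k] M k c := (LinearMap.range (φ k c)).mkQ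
/-- The projection `R² → M'_c`. -/
def pM' : (Fin 2 → R k) →ₗ[R k] M' k c := (LinearMap.range (ψ k c)).mkQ

/-- `R² → M_c` is onto. -/
theorem pM_surjective : Function.Surjective (pM k c) := Submodule.mkQ_surjective _
/-- `R² → M'_c` is onto. -/
theorem pM'_surjective : Function.Surjective (pM' k c) := Submodule.mkQ_surjective _

/-- `pM` is the quotient map. -/
@[simp] theorem pM_apply (v : Fin 2 → R k) : pM k c v = Submodule.Quotient.mk v := rfl

/-- `Ω M_c = ker (R² → M_c) = range φ_c`. -/
theorem ker_pM : LinearMap.ker (pM k c) = LinearMap.range (φ k c) := Submodule.ker_mkQ _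
/-- `Ω M'_c = ker (R² → M'_c) = range ψ_c`. -/
theorem ker_pM' : LinearMap.ker (pM' k c) = LinearMap.range (ψ k c) := Submodule.ker_mkQ _

/-- `S₁ : 0 → Ω M_c → R² → M_c → 0` and `S₂ : 0 → Ω M'_c → R² → M'_c → 0`. -/
abbrev S₁ : ShortComplex (ModuleCat.{0} (R k)) := (pM k c).shortComplexKer
/-- `S₂ : 0 → Ω M'_c → R² → M'_c → 0`. -/
abbrev S₂ : ShortComplex (ModuleCat.{0} (R k)) := (pM' k c).shortComplexKer

/-- `S₁` is short exact. -/
theorem S₁_shortExact : (S₁ k c).ShortExact := LinearMap.shortExact_shortComplexKer (pM_surjective k c)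
/-- `S₂` is short exact. -/
theorem S₂_shortExact : (S₂ k c).ShortExact := LinearMap.shortExact_shortComplexKer (pM'_surjective k c)

/-- 2-periodicity: `M_c ≅ Ω M'_c = ker pM' = range ψ` … -/
def αM : M k c ≃ₗ[R k] LinearMap.ker (pM' k c) :=
  (Submodule.quotEquivOfEq _ _ (ker_ψ k c).symm) ≪≫ₗ (LinearMap.quotKerEquivRange (ψ k c)) ≪≫ₗ
    (LinearEquiv.ofEq _ _ (ker_pM' k c).symm)

/-- … and `M'_c ≅ Ω M_c = ker pM = range φ`. -/
def αM' : M' k c ≃ₗ[R k] LinearMap.ker (pM k c) :=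
  (Submodule.quotEquivOfEq _ _ (ker_φ k c).symm) ≪≫ₗ (LinearMap.quotKerEquivRange (φ k c)) ≪≫ₗ
    (LinearEquiv.ofEq _ _ (ker_pM k c).symm)

/-- The isomorphisms in `ModuleCat`: `S₁.X₃ ≅ S₂.X₁` and `S₂.X₃ ≅ S₁.X₁`. -/
def isoM : (S₁ k c).X₃ ≅ (S₂ k c).X₁ := (αM k c).toModuleIso
/-- `M'_c ≅ Ω M_c` in `ModuleCat R`. -/
def isoM' : (S₂ k c).X₃ ≅ (S₁ k c).X₁ := (αM' k c).toModuleIso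

/-- Top degree: membership in `caⁱ⁺¹(R)` kills `Extⁱ⁺¹` out of `M_c` and out of `M'_c`. -/
theorem kills_of_mem (r : R k) (i : ℕ) (hr : r ∈ cohomologyAnnihilatorOfDegree (R k) (i + 1)) :
    (∀ (Y : ModuleCat.{0} (R k)), Module.Finite (R k) Y → ∀ e : Ext (S₁ k c).X₃ Y (i + 1), r • e = 0) ∧
      (∀ (Y : ModuleCat.{0} (R k)), Module.Finite (R k) Y → ∀ e : Ext (S₂ k c).X₃ Y (i + 1), r • e = 0) := by
  rw [mem_cohomologyAnnihilatorOfDegree_iff] at hr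
  exact ⟨fun Y hY e => hr (i + 1) le_rfl _ Y inferInstance hY e,
    fun Y hY e => hr (i + 1) le_rfl _ Y inferInstance hY e⟩

/-- Periodicity step (the syzygy of `M_c` is `M'_c` and conversely): killing `Extⁱ⁺²` out of both
modules implies killing `Extⁱ⁺¹` out of both. -/
theorem kills_step (r : R k) (i : ℕ)
    (hM : ∀ (Y : ModuleCat.{0} (R k)), Module.Finite (R k) Y → ∀ e : Ext (S₁ k c).X₃ Y (i + 2), r • e = 0)
    (hM' : ∀ (Y : ModuleCat.{0} (R k)), Module.Finite (R k) Y → ∀ e : Ext (S₂ k c).X₃ Y (i + 2), r • e = 0) :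
    (∀ (Y : ModuleCat.{0} (R k)), Module.Finite (R k) Y → ∀ e : Ext (S₁ k c).X₃ Y (i + 1), r • e = 0) ∧
      (∀ (Y : ModuleCat.{0} (R k)), Module.Finite (R k) Y → ∀ e : Ext (S₂ k c).X₃ Y (i + 1), r • e = 0) := by
  constructor
  · intro Y hY e
    -- transport to `S₂.X₁ ≅ M` and shift along `S₂` (whose `X₃ = M'`)
    have h1 : ∀ e' : Ext (S₂ k c).X₁ Y (i + 1), r • e' = 0 :=
      fun e' => smul_ext_eq_zero_of_shortExact (S₂_shortExact k c) r (hM' Y hY) e'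
    exact ext_smul_eq_zero_of_iso (isoM k c).symm (Iso.refl Y) r h1 e
  · intro Y hY e
    have h1 : ∀ e' : Ext (S₁ k c).X₁ Y (i + 1), r • e' = 0 :=
      fun e' => smul_ext_eq_zero_of_shortExact (S₁_shortExact k c) r (hM Y hY) e'
    exact ext_smul_eq_zero_of_iso (isoM' k c).symm (Iso.refl Y) r h1 e

/-- Descent to degree one along the 2-periodic resolution. -/
theorem kills_zero (r : R k) : ∀ i : ℕ,
    (∀ (Y : ModuleCat.{0} (R k)), Module.Finite (R k) Y → ∀ e : Ext (S₁ k c).X₃ Y (i + 1), r • e = 0) →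
    (∀ (Y : ModuleCat.{0} (R k)), Module.Finite (R k) Y → ∀ e : Ext (S₂ k c).X₃ Y (i + 1), r • e = 0) →
      ∀ (Y : ModuleCat.{0} (R k)), Module.Finite (R k) Y → ∀ e : Ext (S₁ k c).X₃ Y 1, r • e = 0
  | 0, h, _ => h
  | i + 1, h, h' => kills_zero r i (kills_step k c r i h h').1 (kills_step k c r i h h').2

/-- If `r ∈ ca(R)` then `r` kills the class of `S₁` in `Ext¹(M_c, Ω M_c)`. -/
theorem smul_extClass_eq_zero {r : R k} (hr : r ∈ cohomologyAnnihilator (R k)) :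
    r • (S₁_shortExact k c).extClass = 0 := by
  obtain ⟨n, hn⟩ := mem_cohomologyAnnihilator_iff.mp hr
  have hn' : r ∈ cohomologyAnnihilatorOfDegree (R k) (n + 1) :=
    cohomologyAnnihilatorOfDegree_mono (Nat.le_succ n) hn
  have h0 := kills_zero k c r n (kills_of_mem k c r n hn').1 (kills_of_mem k c r n hn').2
  exact h0 (S₁ k c).X₁ inferInstance _

end CuspCylinder

/-! ## The obstruction: `s · x ∉ ca(R)` for `s ∉ (x, y)` -/

namespace CuspCylinder

open CategoryTheory CategoryTheory.Abelian Literature.RingTheory.CohomologyAnnihilator Polynomial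

variable (k : Type) [Field k] (c : k)

/-- Splitting: if `r` kills the class of `S₁` in `Ext¹(M_c, Ω M_c)` then `r • 𝟙_{M_c}` lifts
through `R² → M_c` (covariant long exact sequence of `Ext(M_c, -)`). -/
theorem exists_lift_of_smul_extClass_eq_zero {r : R k}
    (h : r • (S₁_shortExact k c).extClass = 0) :
    ∃ σ : M k c →ₗ[R k] (Fin 2 → R k), ∀ m : M k c, pM k c (σ m) = r • m := by
  have hx₃ : (Ext.mk₀ (r • 𝟙 (S₁ k c).X₃)).comp (S₁_shortExact k c).extClass (zero_add 1) = 0 := by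
    rw [Ext.mk₀_smul, Ext.smul_comp, Ext.mk₀_id_comp, h]
  obtain ⟨x₂, hx₂⟩ := Ext.covariant_sequence_exact₃ (S₁ k c).X₃ (S₁_shortExact k c)
    (Ext.mk₀ (r • 𝟙 (S₁ k c).X₃)) (zero_add 1) hx₃
  obtain ⟨σ, rfl⟩ := (Ext.mk₀_bijective _ _).2 x₂
  rw [Ext.mk₀_comp_mk₀] at hx₂
  have hσ : σ ≫ (S₁ k c).g = r • 𝟙 (S₁ k c).X₃ := (Ext.mk₀_bijective _ _).1 hx₂
  refine ⟨σ.hom, fun m => ?_⟩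
  have := congrArg (fun φ => φ.hom m) hσ
  simpa using this

/-- From a lift `σ` of `r • 𝟙_{M_c}`: the scalar identity
`r + (y + xg) κ₀ + (x - g²) κ₁ = (y - xg) l₀ - x² l₁` in `R` for some `κ₀ κ₁ l₀ l₁`. -/
theorem relation_of_lift {r : R k} (σ : M k c →ₗ[R k] (Fin 2 → R k))
    (hσ : ∀ m, pM k c (σ m) = r • m) :
    ∃ κ₀ κ₁ l₀ l₁ : R k,
      r + (y k + x k * zc k c) * κ₀ + (x k - zc k c ^ 2) * κ₁ =
        (y k - x k * zc k c) * l₀ - x k ^ 2 * l₁ := by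
  -- (F) σ (p v) - r • v ∈ range φ
  have hF : ∀ v : Fin 2 → R k, ∃ κ, φ k c κ = σ (pM k c v) - r • v := by
    intro v
    have h1 : pM k c (σ (pM k c v) - r • v) = 0 := by
      rw [map_sub, map_smul, hσ, sub_self]
    rw [pM_apply, Submodule.Quotient.mk_eq_zero, LinearMap.mem_range] at h1
    exact h1
  -- (ii) σ (p (φ w)) = 0
  have hii : ∀ w : Fin 2 → R k, σ (pM k c (φ k c w)) = 0 := by
    intro w
    have : pM k c (φ k c w) = 0 := by
      rw [pM_apply, Submodule.Quotient.mk_eq_zero]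
      exact LinearMap.mem_range_self _ _
    rw [this, map_zero]
  obtain ⟨κ₀, hκ₀⟩ := hF ![1, 0]
  obtain ⟨κ₁, hκ₁⟩ := hF ![0, 1]
  have hφe₀ : φ k c ![1, 0] =
      (y k + x k * zc k c) • (![1, 0] : Fin 2 → R k) + (x k - zc k c ^ 2) • (![0, 1] : Fin 2 → R k) := by
    funext i
    fin_cases i <;> simp [φ]
  have h3 : (y k + x k * zc k c) • σ (pM k c ![1, 0]) + (x k - zc k c ^ 2) • σ (pM k c ![0, 1]) = 0 := by
    have := hii ![1, 0]
    rw [hφe₀] at this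
    simpa only [map_add, map_smul] using this
  have hW : φ k c (r • (![1, 0] : Fin 2 → R k) + (y k + x k * zc k c) • κ₀ + (x k - zc k c ^ 2) • κ₁) = 0 := by
    rw [map_add, map_add, map_smul, map_smul, map_smul, hκ₀, hκ₁, hφe₀, ← h3]
    funext i
    simp only [Pi.add_apply, Pi.smul_apply, Pi.sub_apply, smul_eq_mul]
    ring
  have hWmem : r • (![1, 0] : Fin 2 → R k) + (y k + x k * zc k c) • κ₀ + (x k - zc k c ^ 2) • κ₁ ∈
      LinearMap.range (ψ k c) := by
    rw [← ker_φ]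
    exact hW
  obtain ⟨lam, hlam⟩ := hWmem
  refine ⟨κ₀ 0, κ₁ 0, lam 0, lam 1, ?_⟩
  have h0 := congrFun hlam 0
  simp [ψ, Matrix.vecHead, Matrix.vecTail] at h0
  linear_combination -h0

end CuspCylinder

end Summit.ResolutionOfSingularities.ResolutionOfSingularities.Theorems.Globalisation.Negative

end
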